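import Summits.QuantumAdvantage.QuantumAdvantage.Theorems.LinnikCubicClassGroupsDegreeOnePrimesEscapeRootDiscriminant
import Literature.NumberTheory.NumberFields.UnramifiedIffDiscriminant
import Literature.NumberTheory.NumberFields.UnramifiedCyclicOfPrimeDvdClassNumber
import Literature.NumberTheory.NumberFields.ClassFieldsOfCharactersUniqueness
import HarnessLib

/-!
# Fields of small root discriminant: bounded unramified extensions, bounded class-group characters

Topic `Summits/QuantumAdvantage/QuantumAdvantage/Theorems`, helper file for the crux
`DegreeOnePrimesEscape` (stmt-QuantumAdvantage-11543, closed) of route `LinnikCubicClassGroups`;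
cell B2b-1 (linnik-cubic), PART A. HONEST FRAMING: the value of this file is a THEOREM (explicit,
kernel-checked) — NOT summit progress.

The Masley–Montgomery principle (*Cyclotomic fields with unique factorization*, J. reine angew. Math.
286/287 (1976) — Odlyzko's discriminant bounds against the Hilbert class field) in the form the tree's
explicit Stark–Odlyzko bound (`Discriminant.log_absdiscr_ge_signature`:
`log|d_L| ≥ r₁ log(4πe^γ) + 2r₂ log(2πe^γ) − 2√(π²N/2) − 2`, `N = [L:ℚ]`) allows.  For a number
field `K` of degree `n` with

  `log|d_K| < n·(log 2π + γ)`, i.e. root discriminant `|d_K|^{1/n} < 2πe^γ ≈ 11.19`,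

put `B(K) = ((π√2 + 2)·n / (n(log 2π + γ) − log|d_K|))²`.  Then:

* `finrank_le_of_natAbs_discr_eq_pow` — every number field `L ⊇ K` with `|d_L| = |d_K|^{[L:K]}` has
  `[L:ℚ] ≤ B(K)`; `finrank_le_of_unramified` — in particular every extension `L/K` unramified at all
  finite primes (`Algebra.IsUnramifiedIn (𝓞 L) v` for every nonzero prime `v` of `K`; the tree's
  `forall_isUnramifiedIn_iff_natAbs_discr_eq`) has **`[L:ℚ] ≤ B(K)`** — the degree of unramified
  extensions of a field of small root discriminant is bounded (finite class field tower flavour);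
* `prime_dvd_classNumber_le` — with the tree's class field theory
  (`exists_unramified_isCyclic_card_eq_of_prime_dvd_classNumber`: a prime `p ∣ h_K` gives an unramified
  cyclic extension of degree `p`): **every prime divisor `p` of `h_K` satisfies `p·n ≤ B(K)`**;
* `card_range_classGroupChar_le` — (`exists_classField_char_frobenius` +
  `finrank_eq_card_range_of_classField`: the class field of a character `ψ` of `Cl(𝓞_K)` is unramified
  of degree `|ψ(Cl)|`): **every character `ψ` of the class group has `|ψ(Cl(𝓞_K))|·n ≤ B(K)`**, i.e.
  the exponent of the character group — hence of `Cl(𝓞_K)` — is at most `B(K)/n`.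

(With Odlyzko's sharper constants this is how Masley–Montgomery bound class numbers of cyclotomic
fields; here the constant is Stark's `2πe^γ` and the statements are correspondingly weaker but
unconditional and explicit.)

## References

* J. M. Masley, H. L. Montgomery, *Cyclotomic fields with unique factorization*, J. reine angew.
  Math. 286/287 (1976) 248–256 (method). [MasleyMontgomery1976]
* O. Bordellès, *Arithmetic Tales. Advanced Edition* (2020), Prop. 7.32. [Bordelles2020ArithmeticTales]
-/

noncomputable section

open scoped NumberField nonZeroDivisors
open Complex Filter Topology Set NumberField NumberField.InfinitePlace IsDedekindDomain

namespace Summit.QuantumAdvantage.QuantumAdvantage.Theorems.DegreeOnePrimesEscape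

namespace Discriminant

open Literature.NumberTheory.LFunctions Literature.NumberTheory.LFunctions.NumberField
  Literature.NumberTheory.NumberFields

/-! ### Bounded degree of extensions with `|d_L| = |d_K|^{[L:K]}` -/

/-- **Degree bound for extensions with no relative discriminant.**  Let `K ⊆ L` be number fields with
`|d_L| = |d_K|^{[L:K]}` and `log|d_K| < [K:ℚ](log 2π + γ)`.  Then
`[L:ℚ] ≤ ((π√2 + 2)[K:ℚ] / ([K:ℚ](log 2π + γ) − log|d_K|))²`.
(From `log|d_L| ≥ [L:ℚ](log 2π + γ) − π√(2[L:ℚ]) − 2` and `log|d_L| = [L:K] log|d_K|`.)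
[cite: Bordelles2020ArithmeticTales, Prop. 7.32] -/
theorem finrank_le_of_natAbs_discr_eq_pow (K L : Type*) [Field K] [NumberField K] [Field L]
    [NumberField L] [Algebra K L]
    (hunr : (discr L).natAbs = (discr K).natAbs ^ Module.finrank K L)
    (hsmall : Real.log ((discr K).natAbs : ℝ) <
      Module.finrank ℚ K * (Real.log (2 * Real.pi) + Real.eulerMascheroniConstant)) :
    (Module.finrank ℚ L : ℝ) ≤
      ((Real.pi * Real.sqrt 2 + 2) * Module.finrank ℚ K /
        (Module.finrank ℚ K * (Real.log (2 * Real.pi) + Real.eulerMascheroniConstant) -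
          Real.log ((discr K).natAbs : ℝ))) ^ 2 := by
  set n : ℕ := Module.finrank ℚ K with hn_def
  set m : ℕ := Module.finrank K L with hm_def
  set N : ℕ := Module.finrank ℚ L with hN_def
  set A : ℝ := Real.log (2 * Real.pi) + Real.eulerMascheroniConstant with hA_def
  set ℓ : ℝ := Real.log ((discr K).natAbs : ℝ) with hℓ_def
  have hπ0 := Real.pi_pos
  have hn1 : (1 : ℝ) ≤ n := by rw [hn_def]; exact_mod_cast Module.finrank_pos
  have hN1 : (1 : ℝ) ≤ N := by rw [hN_def]; exact_mod_cast Module.finrank_pos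
  have hNnm : (N : ℝ) = n * m := by
    rw [hN_def, hn_def, hm_def]; exact_mod_cast (Module.finrank_mul_finrank ℚ K L).symm
  -- `log|d_L| = m · log|d_K|`
  have hlogL : Real.log ((discr L).natAbs : ℝ) = m * ℓ := by
    rw [hunr]; push_cast; rw [Real.log_pow]
  -- Stark's bound for `L`
  have hS := log_absdiscr_ge_signature L
  have hrank : (nrRealPlaces L : ℝ) + 2 * nrComplexPlaces L = N := by
    rw [hN_def]; exact_mod_cast card_add_two_mul_card_eq_rank L
  have hr1 : (0 : ℝ) ≤ nrRealPlaces L := Nat.cast_nonneg _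
  have h42 : Real.log (2 * Real.pi) ≤ Real.log (4 * Real.pi) :=
    Real.log_le_log (by positivity) (by linarith)
  have e1 := mul_le_mul_of_nonneg_left h42 hr1
  -- `2√(π²N/2) = π√2·√N`, `s = √N ≥ 1`
  set s : ℝ := Real.sqrt N with hs_def
  have hs1 : 1 ≤ s := by rw [hs_def]; exact Real.one_le_sqrt.2 hN1
  have hs2 : s ^ 2 = N := by rw [hs_def, Real.sq_sqrt (by linarith)]
  have hsq : 2 * Real.sqrt (Real.pi ^ 2 * (N : ℝ) / 2) = Real.pi * Real.sqrt 2 * s := by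
    rw [Real.sqrt_div' _ (by norm_num : (0 : ℝ) ≤ 2), Real.sqrt_mul (sq_nonneg Real.pi),
      Real.sqrt_sq hπ0.le, ← hs_def,
      show 2 * (Real.pi * s / Real.sqrt 2) = Real.pi * s * (2 / Real.sqrt 2) by ring, Real.div_sqrt]
    ring
  rw [hN_def] at hsq
  rw [hsq] at hS
  -- `N · δ ≤ (π√2 + 2) s` with `δ = A − ℓ/n > 0`
  have hδ : 0 < n * A - ℓ := by rw [hA_def, hℓ_def]; linarith
  have hkey : (N : ℝ) * (n * A - ℓ) ≤ (Real.pi * Real.sqrt 2 + 2) * s * n := by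
    -- `N A − (π√2 s + 2) ≤ log|d_L| = m ℓ`, and `N = n m`
    have hNA : (N : ℝ) * A = (nrRealPlaces L : ℝ) * (Real.log (2 * Real.pi) +
        Real.eulerMascheroniConstant) + 2 * (nrComplexPlaces L : ℝ) *
          (Real.log (2 * Real.pi) + Real.eulerMascheroniConstant) := by
      rw [← hrank, hA_def]; ring
    have h1 : (N : ℝ) * A - Real.pi * Real.sqrt 2 * s - 2 ≤ m * ℓ := by
      rw [← hlogL]; linarith [hS, e1, hNA]
    have h2 : (2 : ℝ) ≤ 2 * s := by linarith
    have h3 : (N : ℝ) * (n * A - ℓ) = n * (N * A - m * ℓ) := by rw [hNnm]; ring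
    rw [h3]
    have h4 : (N : ℝ) * A - m * ℓ ≤ (Real.pi * Real.sqrt 2 + 2) * s := by nlinarith
    have hn0 : (0 : ℝ) ≤ n := by linarith
    nlinarith
  -- divide by `s` and square
  have hsδ : s * (n * A - ℓ) ≤ (Real.pi * Real.sqrt 2 + 2) * n := by
    have : s * (s * (n * A - ℓ)) ≤ s * ((Real.pi * Real.sqrt 2 + 2) * n) := by
      have := hkey; rw [← hs2] at this; nlinarith
    exact le_of_mul_le_mul_left this (by linarith)
  have hsle : s ≤ (Real.pi * Real.sqrt 2 + 2) * n / (n * A - ℓ) := by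
    rw [le_div_iff₀ hδ]; exact hsδ
  calc (N : ℝ) = s ^ 2 := hs2.symm
    _ ≤ ((Real.pi * Real.sqrt 2 + 2) * n / (n * A - ℓ)) ^ 2 :=
        pow_le_pow_left₀ (by linarith) hsle 2

/-- **Bounded degree of unramified extensions of a field of small root discriminant.**  If
`log|d_K| < [K:ℚ](log 2π + γ)` (root discriminant below `2πe^γ ≈ 11.19`), then every number field
`L ⊇ K` unramified at every nonzero prime of `K` has
`[L:ℚ] ≤ ((π√2 + 2)[K:ℚ] / ([K:ℚ](log 2π + γ) − log|d_K|))²`.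
[cite: Bordelles2020ArithmeticTales, Prop. 7.32] -/
theorem finrank_le_of_unramified (K L : Type*) [Field K] [NumberField K] [Field L] [NumberField L]
    [Algebra K L] (hunr : ∀ v : HeightOneSpectrum (𝓞 K), Algebra.IsUnramifiedIn (𝓞 L) v.asIdeal)
    (hsmall : Real.log ((discr K).natAbs : ℝ) <
      Module.finrank ℚ K * (Real.log (2 * Real.pi) + Real.eulerMascheroniConstant)) :
    (Module.finrank ℚ L : ℝ) ≤
      ((Real.pi * Real.sqrt 2 + 2) * Module.finrank ℚ K /
        (Module.finrank ℚ K * (Real.log (2 * Real.pi) + Real.eulerMascheroniConstant) -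
          Real.log ((discr K).natAbs : ℝ))) ^ 2 :=
  finrank_le_of_natAbs_discr_eq_pow K L (forall_isUnramifiedIn_iff_natAbs_discr_eq.mp hunr) hsmall

/-! ### Consequences for the class group (class field theory) -/

/-- **Prime divisors of the class number of a field of small root discriminant are bounded**: if
`log|d_K| < [K:ℚ](log 2π + γ)` and `p` is a prime dividing `h_K`, then
`p·[K:ℚ] ≤ ((π√2 + 2)[K:ℚ] / ([K:ℚ](log 2π + γ) − log|d_K|))²` — via the unramified cyclic extension
of degree `p` supplied by class field theory. [cite: MasleyMontgomery1976, §1 (method)] -/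
theorem prime_dvd_classNumber_le (K : Type) [Field K] [NumberField K] {p : ℕ} (hp : p.Prime)
    (hdvd : p ∣ classNumber K)
    (hsmall : Real.log ((discr K).natAbs : ℝ) <
      Module.finrank ℚ K * (Real.log (2 * Real.pi) + Real.eulerMascheroniConstant)) :
    ((p * Module.finrank ℚ K : ℕ) : ℝ) ≤
      ((Real.pi * Real.sqrt 2 + 2) * Module.finrank ℚ K /
        (Module.finrank ℚ K * (Real.log (2 * Real.pi) + Real.eulerMascheroniConstant) -
          Real.log ((discr K).natAbs : ℝ))) ^ 2 := by
  obtain ⟨E, hfd, hgal, hcyc, hcard, hunr⟩ :=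
    exists_unramified_isCyclic_card_eq_of_prime_dvd_classNumber (K := K) hp hdvd
  haveI := hfd
  haveI := hgal
  haveI : NumberField E := NumberField.of_module_finite K E
  have hdeg : Module.finrank K E = p := by rw [← IsGalois.card_aut_eq_finrank, ← hcard]
  have hN : Module.finrank ℚ E = p * Module.finrank ℚ K := by
    rw [← Module.finrank_mul_finrank ℚ K E, hdeg, mul_comm]
  have h := finrank_le_of_unramified K E hunr hsmall
  rwa [hN] at h

/-- **Characters of the class group of a field of small root discriminant have bounded order**: if
`log|d_K| < [K:ℚ](log 2π + γ)`, then for every character `ψ : Cl(𝓞_K) → ℂˣ`,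
`|ψ(Cl(𝓞_K))|·[K:ℚ] ≤ ((π√2 + 2)[K:ℚ] / ([K:ℚ](log 2π + γ) − log|d_K|))²` (the class field of `ψ` is
unramified of degree `|ψ(Cl)|`).  Hence the exponent of the class group is at most this bound divided
by `[K:ℚ]`. [cite: MasleyMontgomery1976, §1 (method)] -/
theorem card_range_classGroupChar_le (K : Type) [Field K] [NumberField K]
    (ψ : ClassGroup (𝓞 K) →* ℂˣ)
    (hsmall : Real.log ((discr K).natAbs : ℝ) <
      Module.finrank ℚ K * (Real.log (2 * Real.pi) + Real.eulerMascheroniConstant)) :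
    ((Nat.card ψ.range * Module.finrank ℚ K : ℕ) : ℝ) ≤
      ((Real.pi * Real.sqrt 2 + 2) * Module.finrank ℚ K /
        (Module.finrank ℚ K * (Real.log (2 * Real.pi) + Real.eulerMascheroniConstant) -
          Real.log ((discr K).natAbs : ℝ))) ^ 2 := by
  obtain ⟨E, hfd, hgal, χ, hcomm, hinj, hunr, hfrob⟩ := exists_classField_char_frobenius ψ
  haveI := hfd
  haveI := hgal
  haveI : NumberField E := NumberField.of_module_finite K E
  have hdeg : Module.finrank K E = Nat.card ψ.range :=
    finrank_eq_card_range_of_classField ψ E χ hcomm hinj hfrob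
  have hN : Module.finrank ℚ E = Nat.card ψ.range * Module.finrank ℚ K := by
    rw [← Module.finrank_mul_finrank ℚ K E, hdeg, mul_comm]
  have h := finrank_le_of_unramified K E hunr hsmall
  rwa [hN] at h

/-! ### Converse reading: a large class-group character forces a root discriminant near `2πe^γ` -/

/-- Real-variable step: if `ℓ < nA` implies `m·n ≤ (Bn/(nA − ℓ))²`, then `ℓ ≥ nA − B√(n/m)`.
[folklore] -/
private theorem le_of_imp_mul_le_sq {n m A ℓ B : ℝ} (hn : 0 < n) (hm : 0 < m) (hB : 0 ≤ B)
    (h : ℓ < n * A → m * n ≤ (B * n / (n * A - ℓ)) ^ 2) :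
    n * A - B * Real.sqrt (n / m) ≤ ℓ := by
  by_contra hlt
  push Not at hlt
  have hs0 : 0 ≤ Real.sqrt (n / m) := Real.sqrt_nonneg _
  have hδ : 0 < n * A - ℓ := by nlinarith
  have h1 := h (by nlinarith)
  have hq : 0 ≤ B * n / (n * A - ℓ) := by positivity
  have h2 : Real.sqrt (m * n) ≤ B * n / (n * A - ℓ) := by
    rw [← Real.sqrt_sq hq]; exact Real.sqrt_le_sqrt h1
  have h3 : (n * A - ℓ) * Real.sqrt (m * n) ≤ B * n := by
    have := mul_le_mul_of_nonneg_left h2 hδ.le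
    rwa [mul_div_cancel₀ _ hδ.ne'] at this
  have hmn : 0 < Real.sqrt (m * n) := Real.sqrt_pos.2 (by positivity)
  have h4 : B * n = B * Real.sqrt (n / m) * Real.sqrt (m * n) := by
    rw [mul_assoc, ← Real.sqrt_mul (by positivity),
      show n / m * (m * n) = n ^ 2 by field_simp, Real.sqrt_sq hn.le]
  rw [h4] at h3
  have h5 : n * A - ℓ ≤ B * Real.sqrt (n / m) := le_of_mul_le_mul_right h3 hmn
  linarith

/-- **A class-group character of large order forces a large root discriminant**: for every number
field `K` of degree `n` and every character `ψ` of `Cl(𝓞_K)` with `|ψ(Cl)| = m`,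
`log|d_K| ≥ n(log 2π + γ) − (π√2 + 2)√(n/m)`; i.e. `|d_K|^{1/n} ≥ 2πe^γ · e^{−(π√2+2)/√(nm)}`
(contrapositive of `card_range_classGroupChar_le`). [cite: MasleyMontgomery1976, §1 (method)] -/
theorem log_absdiscr_ge_of_classGroupChar (K : Type) [Field K] [NumberField K]
    (ψ : ClassGroup (𝓞 K) →* ℂˣ) :
    Module.finrank ℚ K * (Real.log (2 * Real.pi) + Real.eulerMascheroniConstant) -
        (Real.pi * Real.sqrt 2 + 2) * Real.sqrt (Module.finrank ℚ K / Nat.card ψ.range) ≤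
      Real.log ((discr K).natAbs : ℝ) := by
  haveI : Finite ψ.range := inferInstance
  have hm : (0 : ℝ) < Nat.card ψ.range := by exact_mod_cast Nat.card_pos
  have hn : (0 : ℝ) < Module.finrank ℚ K := by exact_mod_cast Module.finrank_pos
  refine le_of_imp_mul_le_sq hn hm (by positivity) fun hsmall ↦ ?_
  have h := card_range_classGroupChar_le K ψ hsmall
  push_cast at h
  exact h

/-- **A prime divisor of the class number forces a large root discriminant**: if `p ∣ h_K` then
`log|d_K| ≥ n(log 2π + γ) − (π√2 + 2)√(n/p)`. [cite: MasleyMontgomery1976, §1 (method)] -/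
theorem log_absdiscr_ge_of_prime_dvd_classNumber (K : Type) [Field K] [NumberField K] {p : ℕ}
    (hp : p.Prime) (hdvd : p ∣ classNumber K) :
    Module.finrank ℚ K * (Real.log (2 * Real.pi) + Real.eulerMascheroniConstant) -
        (Real.pi * Real.sqrt 2 + 2) * Real.sqrt (Module.finrank ℚ K / p) ≤
      Real.log ((discr K).natAbs : ℝ) := by
  have hm : (0 : ℝ) < p := by exact_mod_cast hp.pos
  have hn : (0 : ℝ) < Module.finrank ℚ K := by exact_mod_cast Module.finrank_pos
  refine le_of_imp_mul_le_sq hn hm (by positivity) fun hsmall ↦ ?_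
  have h := prime_dvd_classNumber_le K hp hdvd hsmall
  push_cast at h
  exact h

end Discriminant

end Summit.QuantumAdvantage.QuantumAdvantage.Theorems.DegreeOnePrimesEscape

end
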